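/-
Copyright: the b2b-balaban T⁴-continuum CRUX team, row NE7b OWNER lineage `t4-ne7b-p1` (gen 128). Project licence.
-/
import Summits.QuantumFields.BalabanUV.T4Continuum.Spine.NE7b.SupRegulatedActivityShift
import Literature.Probability.Distributions.MultivariateGaussianWick
import Mathlib.Analysis.Convex.Integral

/-!
# A-PRIORI TWO-SIDED BOUNDS FOR THE FLUCTUATION INTEGRAL AT EVERY EXTERNAL FIELD (the large-field complement of the expansion): for REAL
# per-site remainders that are STABLE (`w_x(t) ≥ −κ₀t²`) and CUBICALLY BOUNDED (`|w_x(t)| ≤ c₃|t|³`), the one-step integral over a Gaussian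
# scale `Z_ψ(Y) = ∫ e^{−Σ_{x∈Y} w_x(ω_x+ψ_x)} dN(0,Γ)(ω)` on ANY finite site set `Y` and at ANY external field `ψ` obeys
#   `exp(−4c₃Σ_{x∈Y}(Γ_xx + 3Γ_xx² + |ψ_x|³)) ≤ Z_ψ(Y) ≤ A^{#Y}·e^{κ₀(1+τ⁻¹)Σ_{x∈Y}ψ_x²}`,  `A = (1−θ)^{−κ₀(1+τ)γ∕θ}`,
# (Jensen below, stability + the Gaussian regulator cost (288) above; `Γ ⪯ γ_op·1`, diagonal `≤ γ`, `2κ₀(1+τ)γ_op ≤ θ < 1`) — so `log Z_ψ(Y)` is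
# EXTENSIVE in `Y` with POLYNOMIAL growth in the external field, site by site, with no smallness assumed anywhere: the bound that pays for
# the cells where the expansion of (289)∕(292)∕(296) is not run (row NE7b, node U5c; (288) + the tree's Wick moments + Mathlib's Jensen
# inequality BY NAME; [folklore])

Cell `pub-balaban`, sub-cell `t4`, spine estimate NE7b (`T4WeightBudget.RelWeightBound`; the cell's OWN estimate — NOT PRINTED in
[Bałaban 1983–89], NOT PROVED).  Crux-route work under `Spine/NE7b/` by the row OWNER (`t4-ne7b-p1` gen 128, file (297)) under FREEZE
(0)'s crux-prover clause, on § [NE7bP1-G127-HANDOFF] NEXT (3)(b) (large-field half of SCOPING-d2); NOTHING of Bałaban's is named as a Lean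
object, valued or asserted; no `T4Continuum/Support` leaf typed; no `def`, no notation; zero `sorry`.  Imports (BY NAME): the OWNER's (288)
`…SupGaussianRegulator` (`integral_exp_half_sq_on_le`, `integrable_exp_half_sq_on`), (292) `…SupRegulatedActivityShift` (`sum_add_sq_le`); the tree's `Literature/Probability/Distributions/
MultivariateGaussianWick` (`integral_eval_mul_eval_multivariateGaussian`, `integral_eval_four_multivariateGaussian`); Mathlib's
`ConvexOn.map_integral_le` (Jensen), `convexOn_exp`, `IsGaussian.memLp_dual`, `MemLp.integrable_norm_pow'`.

WHY (located).  The expansion files give `log Z_ψ(C)` to `O(ε)` precision where the external field is small on cells; where it is large,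
Bałaban does not expand but BOUNDS — and what is needed there is an extensive two-sided bound on the fluctuation integral with controlled
growth in `ψ`, to be multiplied by the Peierls smallness (294) of such cells.  For the road both sides are elementary and typed here:
above by stability and (288)'s regulator cost (quadratic growth in `ψ`), below by Jensen and the Gaussian second∕fourth moments (cubic growth
in `ψ`, via `|t|³ ≤ t² + t⁴` and `|a+b|³ ≤ 4(|a|³+|b|³)`).

WHAT IS PROVED ([folklore]; `μ = multivariateGaussian 0 Γ`):
* §1 real analysis: `abs_cube_le_sq_add_fourth` (`|t|³ ≤ t² + t⁴`), `abs_add_cube_le` (`|a+b|³ ≤ 4(|a|³ + |b|³)`), `neg_sum_le_of_stable`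
  (stability + (292)'s Young `sum_add_sq_le` ⟹ `−Σ_{x∈Y}w_x(ω_x+ψ_x) ≤ κ₀(1+τ)Σω_x² + κ₀(1+τ⁻¹)Σψ_x²`);
* §2 Gaussian moments of one coordinate: `integrable_abs_pow`, `integrable_pow`, `integral_sq_eq` (`= Γ_xx`), `integral_fourth_eq`
  (`= 3Γ_xx²`), `integral_abs_cube_le` (`≤ Γ_xx + 3Γ_xx²`), `integral_abs_add_cube_le` (`∫|ω_x+ψ_x|³ ≤ 4(Γ_xx + 3Γ_xx² + |ψ_x|³)`);
* §3 THE END: **`integral_exp_neg_le`** (the UPPER bound `Z_ψ(Y) ≤ ((1−θ)^{−κ₀(1+τ)γ∕θ})^{#Y}·e^{κ₀(1+τ⁻¹)Σ_{x∈Y}ψ_x²}`), `integrable_exp_neg`,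
  `integrable_sum_remainder`, **`le_integral_exp_neg`** (the LOWER bound `e^{−4c₃Σ_{x∈Y}(Γ_xx+3Γ_xx²+|ψ_x|³)} ≤ Z_ψ(Y)`), and the two-sided
  **`abs_log_integral_exp_neg_le`** (`|log Z_ψ(Y)| ≤ #Y·(κ₀(1+τ)γ∕θ)·log((1−θ)⁻¹) + κ₀(1+τ⁻¹)Σψ_x² + 4c₃Σ(Γ_xx+3Γ_xx²+|ψ_x|³)`); §4 toy.

HONEST (what this is NOT).  Crude bounds (no expansion, no `O(ε)` precision) valid everywhere; the assembly «small-field region by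
(296) + large-field cells by this file × (294)'s Peierls weights ⟹ one extensive bound for the step at all `ψ`» and the iteration are the
successor's; real remainders only (the road's); one scale; scalar skeleton ((A3), NC-NE7b-α UNRULED); nothing of Bałaban's asserted.  BY-NAME
EFFECT ON THE WALL: NONE.  NE7b NOT PRINTED ∕ NOT PROVED; spine PROVED 0∕9; rung (B)+1 — the programme's measures remain FINITE-torus statements;
NOT the mass gap, NOT Clay.  HONEST DEPENDENCY: continuum YM on T⁴ ⇐ BetaPertH ∧ nine spine estimates (0∕9 proved); BetaPertH ⇐ (D1) ∧ (D4) ∧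
CAP+tail; G-an2-4 gates asym, D1 and NE2∕3∕4.
-/

set_option autoImplicit false

noncomputable section

namespace Summit.QuantumFields.BalabanUV.T4Continuum.NE7b.SupFluctuationAPriori

open MeasureTheory ProbabilityTheory Finset Real
open scoped BigOperators ENNReal
open Literature.Probability.Distributions.GaussianWick (integral_eval_mul_eval_multivariateGaussian integral_eval_four_multivariateGaussian)
open SupGaussianRegulator (integral_exp_half_sq_on_le integrable_exp_half_sq_on)
open SupRegulatedActivityShift (sum_add_sq_le)

variable {ι : Type} [Fintype ι] [DecidableEq ι]

/-! ## §1. Real analysis -/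

/-- `|t|³ ≤ t² + t⁴` (`|t| ≤ 1`: `|t|³ ≤ t²`; `|t| ≥ 1`: `|t|³ ≤ t⁴`). [folklore] -/
theorem abs_cube_le_sq_add_fourth (t : ℝ) : |t| ^ 3 ≤ t ^ 2 + t ^ 4 := by
  have h2 : t ^ 2 = |t| ^ 2 := (sq_abs t).symm
  have h4 : t ^ 4 = |t| ^ 4 := ((by decide : Even 4).pow_abs t).symm
  rw [h2, h4]
  have ha : 0 ≤ |t| := abs_nonneg t
  rcases le_or_gt (|t|) 1 with h | h
  · nlinarith [pow_le_pow_left₀ ha h 2, mul_le_mul_of_nonneg_left h (pow_nonneg ha 2), pow_nonneg ha 4]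
  · nlinarith [pow_nonneg ha 2, mul_le_mul_of_nonneg_left h.le (pow_nonneg ha 3)]

/-- `|a + b|³ ≤ 4(|a|³ + |b|³)`. [folklore] -/
theorem abs_add_cube_le (a b : ℝ) : |a + b| ^ 3 ≤ 4 * (|a| ^ 3 + |b| ^ 3) := by
  have h1 : |a + b| ≤ |a| + |b| := abs_add_le a b
  have ha : 0 ≤ |a| := abs_nonneg a
  have hb : 0 ≤ |b| := abs_nonneg b
  have h2 : |a + b| ^ 3 ≤ (|a| + |b|) ^ 3 := pow_le_pow_left₀ (abs_nonneg _) h1 3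
  have h3 : (|a| + |b|) ^ 3 ≤ 4 * (|a| ^ 3 + |b| ^ 3) := by
    nlinarith [mul_nonneg ha hb, sq_nonneg (|a| - |b|), mul_nonneg (mul_nonneg ha hb) (add_nonneg ha hb)]
  exact h2.trans h3

omit [Fintype ι] [DecidableEq ι] in
/-- **STABILITY ⟹ THE EXPONENT IS DOMINATED BY THE TWO REGULATORS**: `w_x(t) ≥ −κ₀t²` (`κ₀ ≥ 0`, `τ > 0`) ⟹
`−Σ_{x∈Y} w_x(ζ_x+ψ_x) ≤ κ₀(1+τ)Σζ_x² + κ₀(1+τ⁻¹)Σψ_x²`. [folklore] -/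
theorem neg_sum_le_of_stable (Y : Finset ι) (w : ι → ℝ → ℝ) {κ₀ τ : ℝ} (hκ₀ : 0 ≤ κ₀) (hτ : 0 < τ)
    (hstab : ∀ x, ∀ t : ℝ, -(κ₀ * t ^ 2) ≤ w x t) (ζ ψ : ι → ℝ) :
    -(∑ x ∈ Y, w x (ζ x + ψ x)) ≤ κ₀ * (1 + τ) * ∑ x ∈ Y, ζ x ^ 2 + κ₀ * (1 + τ⁻¹) * ∑ x ∈ Y, ψ x ^ 2 := by
  have h1 : -(∑ x ∈ Y, w x (ζ x + ψ x)) ≤ κ₀ * ∑ x ∈ Y, (ζ x + ψ x) ^ 2 := by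
    rw [mul_sum, ← sum_neg_distrib]
    exact sum_le_sum fun x _ => by linarith [hstab x (ζ x + ψ x)]
  have h2 := mul_le_mul_of_nonneg_left (sum_add_sq_le Y ζ ψ hτ) hκ₀
  nlinarith [h1, h2]

/-! ## §2. Gaussian moments of one coordinate -/

section Moments

variable {Γ : Matrix ι ι ℝ}

/-- Every absolute moment of a coordinate is finite under `N(0,Γ)`. [folklore] -/
theorem integrable_abs_pow (Γ : Matrix ι ι ℝ) (i : ι) (n : ℕ) :
    Integrable (fun x : EuclideanSpace ℝ ι => |x i| ^ n) (multivariateGaussian 0 Γ) := by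
  have h := (IsGaussian.memLp_dual (multivariateGaussian 0 Γ) (EuclideanSpace.proj i : EuclideanSpace ℝ ι →L[ℝ] ℝ) n
    (ENNReal.natCast_ne_top n)).integrable_norm_pow'
  refine h.congr (ae_of_all _ fun x => ?_)
  simp [Real.norm_eq_abs]

/-- Every moment of a coordinate is finite under `N(0,Γ)`. [folklore] -/
theorem integrable_pow (Γ : Matrix ι ι ℝ) (i : ι) (n : ℕ) :
    Integrable (fun x : EuclideanSpace ℝ ι => x i ^ n) (multivariateGaussian 0 Γ) :=
  (integrable_abs_pow Γ i n).mono' (by fun_prop) (ae_of_all _ fun x => by rw [Real.norm_eq_abs, abs_pow])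

/-- Shifted absolute cubes are integrable. [folklore] -/
theorem integrable_abs_add_cube (Γ : Matrix ι ι ℝ) (i : ι) (c : ℝ) :
    Integrable (fun x : EuclideanSpace ℝ ι => |x i + c| ^ 3) (multivariateGaussian 0 Γ) := by
  refine (((integrable_abs_pow Γ i 3).add (integrable_const (|c| ^ 3))).const_mul 4).mono' (by fun_prop)
    (ae_of_all _ fun x => ?_)
  rw [Real.norm_eq_abs, abs_of_nonneg (pow_nonneg (abs_nonneg _) 3)]
  exact abs_add_cube_le (x i) c

/-- `∫ x_i² dN(0,Γ) = Γ_ii` (`Γ ⪰ 0`). [folklore] -/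
theorem integral_sq_eq (hΓ : Γ.PosSemidef) (i : ι) : ∫ x, x i ^ 2 ∂(multivariateGaussian 0 Γ) = Γ i i := by
  rw [← integral_eval_mul_eval_multivariateGaussian hΓ i i]
  exact integral_congr_ae (ae_of_all _ fun x => by ring)

/-- `∫ x_i⁴ dN(0,Γ) = 3Γ_ii²` (`Γ ⪰ 0`; Wick). [folklore] -/
theorem integral_fourth_eq (hΓ : Γ.PosSemidef) (i : ι) : ∫ x, x i ^ 4 ∂(multivariateGaussian 0 Γ) = 3 * Γ i i ^ 2 := by
  have h := integral_eval_four_multivariateGaussian hΓ (fun _ : Fin 4 => i)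
  have h' : ∫ x, x i ^ 4 ∂(multivariateGaussian 0 Γ) = ∫ x : EuclideanSpace ℝ ι, x i * x i * x i * x i ∂(multivariateGaussian 0 Γ) :=
    integral_congr_ae (ae_of_all _ fun x => by ring)
  rw [h', h]
  ring

/-- `∫ |x_i|³ dN(0,Γ) ≤ Γ_ii + 3Γ_ii²` (`Γ ⪰ 0`). [folklore] -/
theorem integral_abs_cube_le (hΓ : Γ.PosSemidef) (i : ι) :
    ∫ x, |x i| ^ 3 ∂(multivariateGaussian 0 Γ) ≤ Γ i i + 3 * Γ i i ^ 2 := by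
  calc ∫ x, |x i| ^ 3 ∂(multivariateGaussian 0 Γ)
      ≤ ∫ x : EuclideanSpace ℝ ι, (x i ^ 2 + x i ^ 4) ∂(multivariateGaussian 0 Γ) :=
        integral_mono (integrable_abs_pow Γ i 3) ((integrable_pow Γ i 2).add (integrable_pow Γ i 4))
          fun x => abs_cube_le_sq_add_fourth (x i)
    _ = Γ i i + 3 * Γ i i ^ 2 := by
        rw [integral_add (integrable_pow Γ i 2) (integrable_pow Γ i 4), integral_sq_eq hΓ i, integral_fourth_eq hΓ i]

/-- `∫ |x_i + c|³ dN(0,Γ) ≤ 4(Γ_ii + 3Γ_ii² + |c|³)` (`Γ ⪰ 0`). [folklore] -/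
theorem integral_abs_add_cube_le (hΓ : Γ.PosSemidef) (i : ι) (c : ℝ) :
    ∫ x, |x i + c| ^ 3 ∂(multivariateGaussian 0 Γ) ≤ 4 * (Γ i i + 3 * Γ i i ^ 2 + |c| ^ 3) := by
  have h1 : ∫ x, |x i + c| ^ 3 ∂(multivariateGaussian 0 Γ) ≤
      ∫ x : EuclideanSpace ℝ ι, 4 * (|x i| ^ 3 + |c| ^ 3) ∂(multivariateGaussian 0 Γ) :=
    integral_mono (integrable_abs_add_cube Γ i c) (((integrable_abs_pow Γ i 3).add (integrable_const _)).const_mul 4)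
      fun x => abs_add_cube_le (x i) c
  refine h1.trans ?_
  rw [integral_const_mul, integral_add (integrable_abs_pow Γ i 3) (integrable_const _), integral_const, probReal_univ, one_smul]
  nlinarith [integral_abs_cube_le hΓ i]

end Moments

/-! ## §3. THE END: two-sided a-priori bounds at every external field -/

/-- **THE UPPER BOUND (stability + regulator cost).**  `Γ ⪰ 0`, `Γ ⪯ γ_op·1`, `Γ(x,x) ≤ γ` on `Y`; real remainders with `w_x(t) ≥ −κ₀t²`
(`κ₀ ≥ 0`); `0 < τ`, `0 < θ < 1`, `2κ₀(1+τ)γ_op ≤ θ` ⟹ for every external field `ψ`: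
`∫ e^{−Σ_{x∈Y} w_x(ω_x+ψ_x)} dN(0,Γ)(ω) ≤ ((1−θ)^{−(2κ₀(1+τ))γ∕(2θ)})^{#Y} · e^{κ₀(1+τ⁻¹)Σ_{x∈Y}ψ_x²}`. [folklore] -/
theorem integral_exp_neg_le {Γ : Matrix ι ι ℝ} {γop γ : ℝ} (hΓ : Γ.PosSemidef) (hΓop : (γop • (1 : Matrix ι ι ℝ) - Γ).PosSemidef)
    (Y : Finset ι) (hdiag : ∀ i ∈ Y, Γ i i ≤ γ) (w : ι → ℝ → ℝ) {κ₀ τ θ : ℝ} (hκ₀ : 0 ≤ κ₀) (hτ : 0 < τ) (hθ0 : 0 < θ) (hθ1 : θ < 1)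
    (hκθ : 2 * κ₀ * (1 + τ) * γop ≤ θ) (hstab : ∀ x, ∀ t : ℝ, -(κ₀ * t ^ 2) ≤ w x t) (ψ : ι → ℝ) :
    ∫ ω : EuclideanSpace ℝ ι, exp (-(∑ x ∈ Y, w x (ω x + ψ x))) ∂(multivariateGaussian 0 Γ) ≤
      ((1 - θ) ^ (-(2 * κ₀ * (1 + τ) * γ / (2 * θ)))) ^ Y.card * exp (κ₀ * (1 + τ⁻¹) * ∑ x ∈ Y, ψ x ^ 2) := by
  set μ := multivariateGaussian 0 Γ with hμ
  have hκ : 0 ≤ 2 * κ₀ * (1 + τ) := by positivity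
  have hint := integrable_exp_half_sq_on hΓ hΓop hκ hθ1 hκθ Y
  have hgauss := integral_exp_half_sq_on_le hΓ hΓop hκ hθ0 hθ1 hκθ Y hdiag
  have hpt : ∀ ω : EuclideanSpace ℝ ι, exp (-(∑ x ∈ Y, w x (ω x + ψ x))) ≤
      exp (κ₀ * (1 + τ⁻¹) * ∑ x ∈ Y, ψ x ^ 2) * exp (2 * κ₀ * (1 + τ) * (∑ x ∈ Y, ω x ^ 2) / 2) := by
    intro ω
    rw [← exp_add]
    refine exp_le_exp.2 ?_
    have h := neg_sum_le_of_stable Y w hκ₀ hτ hstab (fun x => ω x) ψ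
    linarith
  calc ∫ ω, exp (-(∑ x ∈ Y, w x (ω x + ψ x))) ∂μ
      ≤ ∫ ω : EuclideanSpace ℝ ι, exp (κ₀ * (1 + τ⁻¹) * ∑ x ∈ Y, ψ x ^ 2) * exp (2 * κ₀ * (1 + τ) * (∑ x ∈ Y, ω x ^ 2) / 2) ∂μ :=
        integral_mono_of_nonneg (ae_of_all _ fun _ => (exp_pos _).le) (hint.const_mul _) (ae_of_all _ hpt)
    _ = exp (κ₀ * (1 + τ⁻¹) * ∑ x ∈ Y, ψ x ^ 2) * ∫ ω : EuclideanSpace ℝ ι, exp (2 * κ₀ * (1 + τ) * (∑ x ∈ Y, ω x ^ 2) / 2) ∂μ :=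
        integral_const_mul _ _
    _ ≤ exp (κ₀ * (1 + τ⁻¹) * ∑ x ∈ Y, ψ x ^ 2) * ((1 - θ) ^ (-(2 * κ₀ * (1 + τ) * γ / (2 * θ)))) ^ Y.card :=
        mul_le_mul_of_nonneg_left hgauss (exp_pos _).le
    _ = _ := mul_comm _ _

/-- The integrand `e^{−Σ_{x∈Y}w_x(ω_x+ψ_x)}` is integrable under the hypotheses of the upper bound (measurable remainders). [folklore] -/
theorem integrable_exp_neg {Γ : Matrix ι ι ℝ} {γop : ℝ} (hΓ : Γ.PosSemidef) (hΓop : (γop • (1 : Matrix ι ι ℝ) - Γ).PosSemidef)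
    (Y : Finset ι) (w : ι → ℝ → ℝ) (hw : ∀ x, Measurable (w x)) {κ₀ τ θ : ℝ} (hκ₀ : 0 ≤ κ₀) (hτ : 0 < τ) (hθ1 : θ < 1)
    (hκθ : 2 * κ₀ * (1 + τ) * γop ≤ θ) (hstab : ∀ x, ∀ t : ℝ, -(κ₀ * t ^ 2) ≤ w x t) (ψ : ι → ℝ) :
    Integrable (fun ω : EuclideanSpace ℝ ι => exp (-(∑ x ∈ Y, w x (ω x + ψ x)))) (multivariateGaussian 0 Γ) := by
  have hκ : 0 ≤ 2 * κ₀ * (1 + τ) := by positivity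
  have hint := integrable_exp_half_sq_on hΓ hΓop hκ hθ1 hκθ Y
  have hmeas : Measurable fun ω : EuclideanSpace ℝ ι => exp (-(∑ x ∈ Y, w x (ω x + ψ x))) := by
    refine measurable_exp.comp (Finset.measurable_sum Y fun x _ => ?_).neg
    exact (hw x).comp ((by fun_prop : Measurable fun ω : EuclideanSpace ℝ ι => ω x).add_const (ψ x))
  refine (hint.const_mul (exp (κ₀ * (1 + τ⁻¹) * ∑ x ∈ Y, ψ x ^ 2))).mono' hmeas.aestronglyMeasurable (ae_of_all _ fun ω => ?_)
  rw [Real.norm_eq_abs, abs_of_pos (exp_pos _), ← exp_add]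
  refine exp_le_exp.2 ?_
  have h := neg_sum_le_of_stable Y w hκ₀ hτ hstab (fun x => ω x) ψ
  linarith

/-- The exponent `Σ_{x∈Y}w_x(ω_x+ψ_x)` is integrable for cubically bounded measurable remainders. [folklore] -/
theorem integrable_sum_remainder (Γ : Matrix ι ι ℝ) (Y : Finset ι) (w : ι → ℝ → ℝ) (hw : ∀ x, Measurable (w x)) {c₃ : ℝ}
    (hcub : ∀ x, ∀ t : ℝ, |w x t| ≤ c₃ * |t| ^ 3) (ψ : ι → ℝ) :
    Integrable (fun ω : EuclideanSpace ℝ ι => ∑ x ∈ Y, w x (ω x + ψ x)) (multivariateGaussian 0 Γ) := by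
  refine integrable_finsetSum Y fun x _ => ?_
  have hmeas : Measurable fun ω : EuclideanSpace ℝ ι => w x (ω x + ψ x) :=
    (hw x).comp ((by fun_prop : Measurable fun ω : EuclideanSpace ℝ ι => ω x).add_const (ψ x))
  refine ((integrable_abs_add_cube Γ x (ψ x)).const_mul c₃).mono' hmeas.aestronglyMeasurable (ae_of_all _ fun ω => ?_)
  rw [Real.norm_eq_abs]
  exact hcub x (ω x + ψ x)

/-- **THE LOWER BOUND (Jensen + Gaussian moments).**  `Γ ⪰ 0`, `Γ ⪯ γ_op·1`; real measurable remainders with `w_x(t) ≥ −κ₀t²` (`κ₀ ≥ 0`)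
and `|w_x(t)| ≤ c₃|t|³` (`c₃ ≥ 0`); `0 < τ`, `θ < 1`, `2κ₀(1+τ)γ_op ≤ θ` ⟹ for every external field `ψ`:
`exp(−4c₃·Σ_{x∈Y}(Γ_xx + 3Γ_xx² + |ψ_x|³)) ≤ ∫ e^{−Σ_{x∈Y} w_x(ω_x+ψ_x)} dN(0,Γ)(ω)`. [folklore] -/
theorem le_integral_exp_neg {Γ : Matrix ι ι ℝ} {γop : ℝ} (hΓ : Γ.PosSemidef) (hΓop : (γop • (1 : Matrix ι ι ℝ) - Γ).PosSemidef)
    (Y : Finset ι) (w : ι → ℝ → ℝ) (hw : ∀ x, Measurable (w x)) {κ₀ c₃ τ θ : ℝ} (hκ₀ : 0 ≤ κ₀) (hc₃ : 0 ≤ c₃) (hτ : 0 < τ)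
    (hθ1 : θ < 1) (hκθ : 2 * κ₀ * (1 + τ) * γop ≤ θ) (hstab : ∀ x, ∀ t : ℝ, -(κ₀ * t ^ 2) ≤ w x t)
    (hcub : ∀ x, ∀ t : ℝ, |w x t| ≤ c₃ * |t| ^ 3) (ψ : ι → ℝ) :
    exp (-(4 * c₃ * ∑ x ∈ Y, (Γ x x + 3 * Γ x x ^ 2 + |ψ x| ^ 3))) ≤
      ∫ ω : EuclideanSpace ℝ ι, exp (-(∑ x ∈ Y, w x (ω x + ψ x))) ∂(multivariateGaussian 0 Γ) := by
  set μ := multivariateGaussian 0 Γ with hμ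
  have hfi : Integrable (fun ω : EuclideanSpace ℝ ι => -(∑ x ∈ Y, w x (ω x + ψ x))) μ := (integrable_sum_remainder Γ Y w hw hcub ψ).neg
  have hgi : Integrable (fun ω : EuclideanSpace ℝ ι => exp (-(∑ x ∈ Y, w x (ω x + ψ x)))) μ :=
    integrable_exp_neg hΓ hΓop Y w hw hκ₀ hτ hθ1 hκθ hstab ψ
  -- Jensen: `exp(∫ f) ≤ ∫ exp ∘ f`
  have hJ := ConvexOn.map_integral_le (μ := μ) (f := fun ω : EuclideanSpace ℝ ι => -(∑ x ∈ Y, w x (ω x + ψ x)))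
    convexOn_exp continuous_exp.continuousOn isClosed_univ (ae_of_all _ fun _ => Set.mem_univ _) hfi hgi
  refine le_trans (exp_le_exp.2 ?_) hJ
  -- `−4c₃Σ(…) ≤ ∫ −Σ w = −Σ ∫ w`
  have hwint : ∀ x, Integrable (fun ω : EuclideanSpace ℝ ι => w x (ω x + ψ x)) μ := by
    intro x
    have hmeas : Measurable fun ω : EuclideanSpace ℝ ι => w x (ω x + ψ x) :=
      (hw x).comp ((by fun_prop : Measurable fun ω : EuclideanSpace ℝ ι => ω x).add_const (ψ x))
    exact ((integrable_abs_add_cube Γ x (ψ x)).const_mul c₃).mono' hmeas.aestronglyMeasurable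
      (ae_of_all _ fun ω => by rw [Real.norm_eq_abs]; exact hcub x (ω x + ψ x))
  rw [integral_neg, integral_finsetSum Y fun x _ => hwint x, neg_le_neg_iff, mul_sum]
  refine sum_le_sum fun x _ => ?_
  calc ∫ ω, w x (ω x + ψ x) ∂μ ≤ ∫ ω : EuclideanSpace ℝ ι, c₃ * |ω x + ψ x| ^ 3 ∂μ :=
        integral_mono (hwint x) ((integrable_abs_add_cube Γ x (ψ x)).const_mul c₃)
          fun ω => (le_abs_self _).trans (hcub x (ω x + ψ x))
    _ = c₃ * ∫ ω : EuclideanSpace ℝ ι, |ω x + ψ x| ^ 3 ∂μ := integral_const_mul _ _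
    _ ≤ c₃ * (4 * (Γ x x + 3 * Γ x x ^ 2 + |ψ x| ^ 3)) := mul_le_mul_of_nonneg_left (integral_abs_add_cube_le hΓ x (ψ x)) hc₃
    _ = 4 * c₃ * (Γ x x + 3 * Γ x x ^ 2 + |ψ x| ^ 3) := by ring

/-- **THE END — `log Z_ψ(Y)` IS EXTENSIVE WITH POLYNOMIAL GROWTH IN THE EXTERNAL FIELD, FOR EVERY `ψ`.**  Under the hypotheses of the two bounds
(`Γ ⪰ 0`, `Γ ⪯ γ_op·1`, `Γ(x,x) ≤ γ` on `Y`, `γ ≥ 0`; real measurable remainders, stable with `κ₀ ≥ 0` and cubically bounded with `c₃ ≥ 0`; `0 < τ`,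
`0 < θ < 1`, `2κ₀(1+τ)γ_op ≤ θ`):
`|log ∫ e^{−Σ_{x∈Y} w_x(ω_x+ψ_x)} dN(0,Γ)| ≤ #Y·(2κ₀(1+τ)γ∕(2θ))·(−log(1−θ)) + κ₀(1+τ⁻¹)Σ_{x∈Y}ψ_x² + 4c₃Σ_{x∈Y}(Γ_xx + 3Γ_xx² + |ψ_x|³)`.
[folklore] -/
theorem abs_log_integral_exp_neg_le {Γ : Matrix ι ι ℝ} {γop γ : ℝ} (hΓ : Γ.PosSemidef)
    (hΓop : (γop • (1 : Matrix ι ι ℝ) - Γ).PosSemidef) (Y : Finset ι) (hdiag : ∀ i ∈ Y, Γ i i ≤ γ) (w : ι → ℝ → ℝ)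
    (hγ : 0 ≤ γ) (hw : ∀ x, Measurable (w x)) {κ₀ c₃ τ θ : ℝ} (hκ₀ : 0 ≤ κ₀) (hc₃ : 0 ≤ c₃) (hτ : 0 < τ) (hθ0 : 0 < θ)
    (hθ1 : θ < 1) (hκθ : 2 * κ₀ * (1 + τ) * γop ≤ θ) (hstab : ∀ x, ∀ t : ℝ, -(κ₀ * t ^ 2) ≤ w x t)
    (hcub : ∀ x, ∀ t : ℝ, |w x t| ≤ c₃ * |t| ^ 3) (ψ : ι → ℝ) :
    |log (∫ ω : EuclideanSpace ℝ ι, exp (-(∑ x ∈ Y, w x (ω x + ψ x))) ∂(multivariateGaussian 0 Γ))| ≤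
      Y.card * (2 * κ₀ * (1 + τ) * γ / (2 * θ)) * (-log (1 - θ)) + κ₀ * (1 + τ⁻¹) * ∑ x ∈ Y, ψ x ^ 2 +
        4 * c₃ * ∑ x ∈ Y, (Γ x x + 3 * Γ x x ^ 2 + |ψ x| ^ 3) := by
  set Z := ∫ ω : EuclideanSpace ℝ ι, exp (-(∑ x ∈ Y, w x (ω x + ψ x))) ∂(multivariateGaussian 0 Γ) with hZ
  have hlow := le_integral_exp_neg hΓ hΓop Y w hw hκ₀ hc₃ hτ hθ1 hκθ hstab hcub ψ
  have hup := integral_exp_neg_le hΓ hΓop Y hdiag w hκ₀ hτ hθ0 hθ1 hκθ hstab ψ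
  have hZpos : 0 < Z := lt_of_lt_of_le (exp_pos _) hlow
  have h1θ : 0 < 1 - θ := by linarith
  -- lower: `log Z ≥ −4c₃Σ(…)`
  have hlogl : -(4 * c₃ * ∑ x ∈ Y, (Γ x x + 3 * Γ x x ^ 2 + |ψ x| ^ 3)) ≤ log Z := by
    rw [← log_exp (-(4 * c₃ * ∑ x ∈ Y, (Γ x x + 3 * Γ x x ^ 2 + |ψ x| ^ 3)))]
    exact log_le_log (exp_pos _) hlow
  -- upper: `log Z ≤ #Y·e·(−log(1−θ)) + κ₀(1+τ⁻¹)Σψ²`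
  have hlogu : log Z ≤ Y.card * (2 * κ₀ * (1 + τ) * γ / (2 * θ)) * (-log (1 - θ)) + κ₀ * (1 + τ⁻¹) * ∑ x ∈ Y, ψ x ^ 2 := by
    have hApos : 0 < (1 - θ) ^ (-(2 * κ₀ * (1 + τ) * γ / (2 * θ))) := rpow_pos_of_pos h1θ _
    have h := log_le_log hZpos hup
    rw [log_mul (pow_pos hApos _).ne' (exp_pos _).ne', log_exp, log_pow, log_rpow h1θ] at h
    have heq : (Y.card : ℝ) * (-(2 * κ₀ * (1 + τ) * γ / (2 * θ)) * log (1 - θ)) =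
        Y.card * (2 * κ₀ * (1 + τ) * γ / (2 * θ)) * (-log (1 - θ)) := by ring
    linarith [heq]
  -- the two nonnegative budgets
  have hB1 : 0 ≤ κ₀ * (1 + τ⁻¹) * ∑ x ∈ Y, ψ x ^ 2 :=
    mul_nonneg (mul_nonneg hκ₀ (by positivity)) (sum_nonneg fun x _ => sq_nonneg _)
  have hdiag0 : ∀ x ∈ Y, 0 ≤ Γ x x := fun x _ => hΓ.diag_nonneg
  have hB2 : 0 ≤ 4 * c₃ * ∑ x ∈ Y, (Γ x x + 3 * Γ x x ^ 2 + |ψ x| ^ 3) :=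
    mul_nonneg (by positivity) (sum_nonneg fun x hx => by have := hdiag0 x hx; positivity)
  have hB0 : 0 ≤ (Y.card : ℝ) * (2 * κ₀ * (1 + τ) * γ / (2 * θ)) * (-log (1 - θ)) := by
    have hlog : 0 ≤ -log (1 - θ) := by rw [neg_nonneg]; exact log_nonpos h1θ.le (by linarith)
    positivity
  rw [abs_le]
  constructor <;> linarith

/-! ## §4. Toy -/

/-- Toy (§1): `|1 + 1|³ = 8 ≤ 4·(1 + 1)`. -/
example : |(1 : ℝ) + 1| ^ 3 ≤ 4 * (|(1 : ℝ)| ^ 3 + |(1 : ℝ)| ^ 3) := abs_add_cube_le 1 1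

end Summit.QuantumFields.BalabanUV.T4Continuum.NE7b.SupFluctuationAPriori
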